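import Summits.QuantumFields.BalabanUV.T4Continuum.Support.RegionStarLineGaugeBound
import Summits.QuantumFields.BalabanUV.T4Continuum.Support.RegionGaugeOrbit

/-!
# `BalabanUV.T4Continuum.Support.RegionStarLineGaugeEnd` — NE2 (node U1a) formalisation swarm, SUPPLIER item «Δ1-COERC-ORTH-LINE» under the
# owner's sub-row `T4-U1a.S-NE2-D1-DIRICHLET°` (vector layer, W1): THE DISPLAYED W1 INEQUALITY HOLDS ON EVERY `e`-THIN BLOCK SET — the line
# gauge is a good Dirichlet gauge, `nsq (A − ∂_Ω(lineGauge A)) ≤ 40·nsq (curlR A) + 16·n^d·nsq (avgR A)`, hence `OrthSliceCoercive`,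
# `SliceCoercive`, a coercivity constant and a bound on `‖G(Ω₀)‖ = ‖Δ_a(Ω₀)⁻¹‖` for the [B9]-faithful `U = 1` region vector operator, with
# constants depending on `d`, `a`, `a′` ONLY — uniform in `n = η⁻¹`, the torus `M` and the block set within the class
# (unit b2b-balaban-t4-ne2-formalise-leaf-09, gen 9, v1)

HONEST FRAMING (T4-DAG p. 1).  [folklore] `U = 1`, ONE region of the restricted class `IsEThin e S` (no two blocks of `S` `e`-adjacent or
`(e,ν)`-diagonally adjacent: single blocks, `e`-slabs of thickness one, rods, `e`-thin cylinders — non-vacuity lemmas below), ONE averaging scale,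
finite torus, `2 ≤ n`; this IS the located open estimate W1 (G-ne2leaf07g5-1, memo `t4/T4-EST-NE2-D1-COERC.md` §6) FOR THAT CLASS and nothing
more: W1 for general unions of unit blocks stays OPEN (re-entrant `(e,ν)`-corners break the line gauge's anchors; `e`-stacked blocks need a
two-scale gluing — located, not attempted here); nothing printed is a hypothesis; NE2 (U1a) NOT proved; spine PROVED 0/9 unchanged; NOT [B9]
(3.23)–(3.27) as printed; NOT infinite volume, NOT the mass gap, NOT Clay.  HONEST DEPENDENCY (verbatim): «continuum YM on T⁴ ⇐ BetaPertH ∧ nine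
spine estimates (0/9 proved); BetaPertH ⇐ (D1) ∧ (D4) ∧ CAP+tail; G-an2-4 gates asym, D1 and NE2/3/4.»

WHAT THIS FILE PROVES (0 sorry):
 * §1 THE SUMS from the pointwise bounds of `RegionStarLineGaugeRegion` and the bookkeeping of `RegionStarLineGaugeBound`:
   **`sum_res_e_sq_le`** `Σ_x ‖res (x,e)‖² ≤ 4·T + 16·n^d·nsq (Q ext A)`, **`sum_res_nu_sq_le`** `Σ_x ‖res (x,ν)‖² ≤ 16·Σ_z ‖F_{eν}(z)‖²` (`ν ≠ e`),
   `T = Σ_{ν≠e} Σ_z ‖F_{eν}(z)‖² ≤ 2·nsq (curlR A)` (`curl_lines_le`), `nsq_res_eq` (splitting `nsq (res A)` by direction).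
 * §2 THE ORBIT INEQUALITY **`nsq_sub_gradR_lineGauge_le (h : IsEThin M e S) : nsq (A − gradR (lineGauge A)) ≤ 40·nsq (curlR A) + 16·n^d·nsq (avgR A)`**.
 * §3 THE W1 ENDs for `e`-thin sets (`2 ≤ n`, `0 < a`, `0 < a′`): **`orthSlice_of_isEThin`** (`OrthSliceCoercive … (a·n^d) (orbitConst d a 40 16)`,
   gen 9's `RegionGaugeOrbit.orthSlice_of_gaugePoincare`), **`sliceCoercive_of_isEThin`** (leaf-07-g5's displayed W1 binder `SliceCoercive (curlR) (gradR)
   (GOm) (QOm) (avgR) (a·n^d) c` with `c = orbitConst d a 40 16/(1 + 4d/σ₀(d,a′))`, gen 8's `sliceCoercive_region_of_orthSlice`),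
   **`coercive_regionDeltaA_of_isEThin`**, **`opNorm_inv_regionDeltaA_le_of_isEThin`** — the owner's W1 socket `hS`/`hcoer` for the star-bond tower,
   supplied on the class with level-uniform constants.
 * §4 NON-VACUITY: `isEThin_of_levels` (the `e`-levels of `S` lie in a set without consecutive elements ⟹ `e`-thin, ANY transverse shape),
   `isEThin_single` (a single block, `2 ≤ M e`), `isEThin_slab` (`{y : y_e = c}`), `isEThin_cylinder` (`{y : I (y_e) ∧ T y}`, `I` `e`-isolated).

ABSOLUTE RULE (cell, verbatim): «No internally-minted statement may enter as a cited fact. Every hypothesis is either kernel-proved in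
this package or a verbatim quotation of a PUBLISHED theorem with page reference. The manuscript(s) under audit are NOT citable for
their own disputed steps — they are the thing under adjudication; programme-internal (2001/route/tribunal) claims are never citable.»
[folklore] throughout; no def, no `def … : Prop`.  NOT CLAIMED: W1 beyond `e`-thin sets («SliceCoercive proved» ONLY with «on `e`-thin block
sets»); NE2; NE3; «not in print; our estimate».
-/

noncomputable section

open scoped BigOperators ComplexConjugate Matrix Matrix.Norms.L2Operator
open Finset

namespace Summit.QuantumFields.BalabanUV.T4Continuum.RegionStarLineGaugeEnd

open Literature.MathematicalPhysics.QuantumFieldTheory.Balaban1983to89.B5Prop11Plancherel (Tor fine unitVec)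
open Literature.MathematicalPhysics.QuantumFieldTheory.Balaban1983to89.B5Prop11Lower (nsq nsq_nonneg)
open Literature.MathematicalPhysics.QuantumFieldTheory.Balaban1983to89.B5Action121 (Fs CurlOp CurlOp_mulVec)
open Literature.MathematicalPhysics.QuantumFieldTheory.Balaban1983to89.B5Block118 (bpt tstep QvOp)
open Literature.MathematicalPhysics.QuantumFieldTheory.Balaban1983to89.B5AverageCurlStokes (sum_translate)
open Summit.QuantumFields.BalabanUV.T4Continuum
open Summit.QuantumFields.BalabanUV.T4Continuum.SubtypeCompression (Coercive ext nsq_ext)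
open Summit.QuantumFields.BalabanUV.T4Continuum.ScalarBlockPoincare (nsq_smul)
open Summit.QuantumFields.BalabanUV.T4Continuum.ScalarAveragedPropagator (gammaPs)
open Summit.QuantumFields.BalabanUV.T4Continuum.ScalarAveragedCompression (sigma0 sigma0_pos)
open Summit.QuantumFields.BalabanUV.T4Continuum.RegionScalarCompression (QOm GOm)
open Summit.QuantumFields.BalabanUV.T4Continuum.RegionGaugeFixedVector (starReg curlR gradR avgR regionDeltaA)
open Summit.QuantumFields.BalabanUV.T4Continuum.RegionGaugeFixedVectorFlat (submatrix_mulVec_eq avgR_mulVec)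
open Summit.QuantumFields.BalabanUV.T4Continuum.RegionGaugeSlice (SliceCoercive)
open Summit.QuantumFields.BalabanUV.T4Continuum.RegionGaugeSliceOrth (OrthSliceCoercive)
open Summit.QuantumFields.BalabanUV.T4Continuum.RegionGaugeSliceOrthRegion (sliceCoercive_region_of_orthSlice coercive_regionDeltaA_of_orthSlice
  opNorm_inv_regionDeltaA_le_of_orthSlice)
open Summit.QuantumFields.BalabanUV.T4Continuum.RegionGaugeOrbit (orbitConst orbitConst_pos orthSlice_of_gaugePoincare)
open Summit.QuantumFields.BalabanUV.T4Continuum.RegionStarLineGauge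
open Summit.QuantumFields.BalabanUV.T4Continuum.RegionStarLineGaugeRegion
open Summit.QuantumFields.BalabanUV.T4Continuum.RegionStarLineGaugeBound
open Summit.QuantumFields.BalabanUV.Beta.GAN24.DirichletBoxTrace (blockReg)

variable {d : ℕ} (n : ℕ) [NeZero n] (M : Fin d → ℕ) [hM : ∀ μ, NeZero (M μ)] (e : Fin d) {S : Tor M → Prop} [DecidablePred S]
variable (A : {b // starReg n M S b} → ℂ)

/-! ## §1 The sums -/

omit [DecidablePred S] in
/-- translation invariance of a fine-torus sum of reals (`x ↦ x − v`). [folklore] -/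
theorem sum_fine_sub_shift (F : Tor (fine n M) → ℝ) (v : Tor (fine n M)) : ∑ x, F (x - v) = ∑ x, F x :=
  Equiv.sum_comp (Equiv.subRight v) F

omit [NeZero n] [DecidablePred S] in
/-- translation invariance of a unit-torus sum of reals (`y ↦ y − v`). [folklore] -/
theorem sum_coarse_sub_shift (F : Tor M → ℝ) (v : Tor M) : ∑ y, F (y - v) = ∑ y, F y :=
  Equiv.sum_comp (Equiv.subRight v) F



/-- **THE `e`-BONDS**: `Σ_x ‖res (x,e)‖² ≤ 4·Σ_{ν≠e} Σ_z ‖F_{eν}(z)‖² + 16·n^d·nsq (Q ext A)`. [folklore] -/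
theorem sum_res_e_sq_le (h : IsEThin M e S) :
    ∑ x, ‖res n M e S A (x, e)‖ ^ 2
      ≤ 4 * ∑ ν ∈ univ.filter (fun ν : Fin d => ν ≠ e), ∑ z, ‖Fs (fine n M) (n : ℂ) (ext (starReg n M S) A) e ν z‖ ^ 2
        + 16 * ((n : ℝ) ^ d * nsq (QvOp n M *ᵥ ext (starReg n M S) A)) := by
  set Z := ext (starReg n M S) A with hZ
  have hn0 : (0 : ℝ) < n := by exact_mod_cast Nat.pos_of_ne_zero (NeZero.ne n)
  have hn1 : (0 : ℝ) < (n : ℝ) + 1 := by positivity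
  set W : Tor (fine n M) → ℝ := fun x => if blockReg n M S x then ‖ell n M e Z x‖ ^ 2 else 0 with hW
  -- (1) pointwise and the translation
  have h1 : ∑ x, ‖res n M e S A (x, e)‖ ^ 2 ≤ (2 / ((n : ℝ) + 1) ^ 2) * ∑ x, W x := by
    calc ∑ x, ‖res n M e S A (x, e)‖ ^ 2 ≤ ∑ x, (W x + W (x + unitVec (fine n M) e)) / ((n : ℝ) + 1) ^ 2 :=
          sum_le_sum fun x _ => norm_sq_res_e_le n M e A h x
      _ = (2 / ((n : ℝ) + 1) ^ 2) * ∑ x, W x := by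
          rw [← sum_div, sum_add_distrib, sum_translate n M W (unitVec (fine n M) e)]; ring
  -- (2) the region sum in the chart and the per-block bound
  have h2 : ∑ x, W x ≤ ∑ y : Tor M, (if S y then
      (((n : ℝ) + 1) * ∑ ν ∈ univ.filter (fun ν : Fin d => ν ≠ e), ∑ j : Fin d → Fin n, lineCurl n M e Z ν (bpt n M y j)
        + 4 * (n : ℝ) ^ (d + 2) * (‖(QvOp n M *ᵥ Z) (y - unitVec M e, e)‖ ^ 2 + ‖(QvOp n M *ᵥ Z) (y, e)‖ ^ 2)) else 0) := by
    rw [hW, sum_region_eq n M S]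
    refine sum_le_sum fun y _ => ?_
    split_ifs with hy
    · exact sum_block_ell_sq_le n M e A h hy
    · exact le_rfl
  -- (3) the curl part: back to a region sum of line curls, then the line-counting lemma
  have h3 : ∀ ν : Fin d, ∑ y : Tor M, (if S y then ∑ j : Fin d → Fin n, lineCurl n M e Z ν (bpt n M y j) else 0)
      ≤ 2 * n * ∑ z, ‖Fs (fine n M) (n : ℂ) Z e ν z‖ ^ 2 := by
    intro ν
    rw [← sum_region_eq n M S (fun x => lineCurl n M e Z ν x)]
    exact sum_region_lineFun_le n M e S (g := fun z => ‖Fs (fine n M) (n : ℂ) Z e ν z‖ ^ 2) fun z => by positivity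
  -- (4) the mean part: two copies of `Σ_y ‖(QZ)(y,e)‖² ≤ nsq (QZ)`
  have h4 : ∑ y : Tor M, ‖(QvOp n M *ᵥ Z) (y, e)‖ ^ 2 ≤ nsq (QvOp n M *ᵥ Z) := by
    unfold nsq
    rw [Fintype.sum_prod_type]
    exact sum_le_sum fun y _ => single_le_sum (f := fun μ => ‖(QvOp n M *ᵥ Z) (y, μ)‖ ^ 2) (fun _ _ => by positivity) (mem_univ e)
  have h4' : ∑ y : Tor M, ‖(QvOp n M *ᵥ Z) (y - unitVec M e, e)‖ ^ 2 ≤ nsq (QvOp n M *ᵥ Z) := by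
    rw [sum_coarse_sub_shift M (fun y => ‖(QvOp n M *ᵥ Z) (y, e)‖ ^ 2) (unitVec M e)]; exact h4
  -- assemble: split the indicator sum into the curl part (indicator kept) and the mean part (indicator dropped)
  set C : Fin d → Tor M → ℝ := fun ν y => if S y then ∑ j : Fin d → Fin n, lineCurl n M e Z ν (bpt n M y j) else 0 with hC
  set D : Tor M → ℝ := fun y => ‖(QvOp n M *ᵥ Z) (y - unitVec M e, e)‖ ^ 2 + ‖(QvOp n M *ᵥ Z) (y, e)‖ ^ 2 with hD
  have hsplit : ∑ y : Tor M, (if S y then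
      (((n : ℝ) + 1) * ∑ ν ∈ univ.filter (fun ν : Fin d => ν ≠ e), ∑ j : Fin d → Fin n, lineCurl n M e Z ν (bpt n M y j)
        + 4 * (n : ℝ) ^ (d + 2) * (‖(QvOp n M *ᵥ Z) (y - unitVec M e, e)‖ ^ 2 + ‖(QvOp n M *ᵥ Z) (y, e)‖ ^ 2)) else 0)
      ≤ ((n : ℝ) + 1) * ∑ ν ∈ univ.filter (fun ν : Fin d => ν ≠ e), ∑ y : Tor M, C ν y + 4 * (n : ℝ) ^ (d + 2) * ∑ y : Tor M, D y := by
    have hpt : ∀ y : Tor M, (if S y then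
        (((n : ℝ) + 1) * ∑ ν ∈ univ.filter (fun ν : Fin d => ν ≠ e), ∑ j : Fin d → Fin n, lineCurl n M e Z ν (bpt n M y j)
          + 4 * (n : ℝ) ^ (d + 2) * (‖(QvOp n M *ᵥ Z) (y - unitVec M e, e)‖ ^ 2 + ‖(QvOp n M *ᵥ Z) (y, e)‖ ^ 2)) else 0)
        ≤ ((n : ℝ) + 1) * ∑ ν ∈ univ.filter (fun ν : Fin d => ν ≠ e), C ν y + 4 * (n : ℝ) ^ (d + 2) * D y := by
      intro y
      by_cases hy : S y
      · simp only [hC, hD, if_pos hy]; exact le_rfl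
      · simp only [hC, hD, if_neg hy, sum_const_zero, mul_zero, zero_add]; positivity
    refine (sum_le_sum fun y _ => hpt y).trans (le_of_eq ?_)
    rw [sum_add_distrib, ← mul_sum, ← mul_sum, sum_comm]
  have hDle : ∑ y : Tor M, D y ≤ nsq (QvOp n M *ᵥ Z) + nsq (QvOp n M *ᵥ Z) := by
    rw [hD]; simp only; rw [sum_add_distrib]; exact add_le_add h4' h4
  have hT0 : 0 ≤ ∑ ν ∈ univ.filter (fun ν : Fin d => ν ≠ e), ∑ z, ‖Fs (fine n M) (n : ℂ) Z e ν z‖ ^ 2 :=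
    sum_nonneg fun _ _ => sum_nonneg fun _ _ => by positivity
  have hQ0 := nsq_nonneg (QvOp n M *ᵥ Z)
  calc ∑ x, ‖res n M e S A (x, e)‖ ^ 2 ≤ (2 / ((n : ℝ) + 1) ^ 2) * ∑ x, W x := h1
    _ ≤ (2 / ((n : ℝ) + 1) ^ 2) * (((n : ℝ) + 1) * ∑ ν ∈ univ.filter (fun ν : Fin d => ν ≠ e), (2 * n * ∑ z, ‖Fs (fine n M) (n : ℂ) Z e ν z‖ ^ 2)
        + 4 * (n : ℝ) ^ (d + 2) * (nsq (QvOp n M *ᵥ Z) + nsq (QvOp n M *ᵥ Z))) := by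
        refine mul_le_mul_of_nonneg_left (h2.trans (hsplit.trans ?_)) (by positivity)
        have hCle : ∑ ν ∈ univ.filter (fun ν : Fin d => ν ≠ e), ∑ y : Tor M, C ν y
            ≤ ∑ ν ∈ univ.filter (fun ν : Fin d => ν ≠ e), (2 * n * ∑ z, ‖Fs (fine n M) (n : ℂ) Z e ν z‖ ^ 2) :=
          sum_le_sum fun ν _ => h3 ν
        gcongr
    _ = (4 * n / ((n : ℝ) + 1)) * ∑ ν ∈ univ.filter (fun ν : Fin d => ν ≠ e), ∑ z, ‖Fs (fine n M) (n : ℂ) Z e ν z‖ ^ 2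
        + (16 * (n : ℝ) ^ 2 / ((n : ℝ) + 1) ^ 2) * ((n : ℝ) ^ d * nsq (QvOp n M *ᵥ Z)) := by
        rw [← mul_sum]; field_simp; ring
    _ ≤ 4 * ∑ ν ∈ univ.filter (fun ν : Fin d => ν ≠ e), ∑ z, ‖Fs (fine n M) (n : ℂ) Z e ν z‖ ^ 2
        + 16 * ((n : ℝ) ^ d * nsq (QvOp n M *ᵥ Z)) := by
        have c1 : 4 * n / ((n : ℝ) + 1) ≤ 4 := by rw [div_le_iff₀ hn1]; linarith
        have c2 : 16 * (n : ℝ) ^ 2 / ((n : ℝ) + 1) ^ 2 ≤ 16 := by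
          rw [div_le_iff₀ (by positivity)]; nlinarith
        gcongr

/-- **THE TRANSVERSE BONDS** (`ν ≠ e`): `Σ_x ‖res (x,ν)‖² ≤ 16·Σ_z ‖F_{eν}(z)‖²`. [folklore] -/
theorem sum_res_nu_sq_le (h : IsEThin M e S) {ν : Fin d} (hν : ν ≠ e) :
    ∑ x, ‖res n M e S A (x, ν)‖ ^ 2 ≤ 16 * ∑ z, ‖Fs (fine n M) (n : ℂ) (ext (starReg n M S) A) e ν z‖ ^ 2 := by
  set Z := ext (starReg n M S) A with hZ
  have hn0 : (0 : ℝ) < n := by exact_mod_cast Nat.pos_of_ne_zero (NeZero.ne n)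
  set g : Tor (fine n M) → ℝ := fun z => ‖Fs (fine n M) (n : ℂ) Z e ν z‖ ^ 2 with hg
  have hg0 : ∀ z, 0 ≤ g z := fun z => by positivity
  -- the two region sums of line curls
  have hA : ∑ x, (if blockReg n M S x then lineCurl n M e Z ν x else 0) ≤ 2 * n * ∑ z, g z :=
    sum_region_lineFun_le n M e S hg0
  have hB : ∑ x, (if blockReg n M S (x + unitVec (fine n M) ν) then lineCurl n M e Z ν x else 0) ≤ 2 * n * ∑ z, g z := by
    -- shift `x = z − e_ν`: the line of `z − e_ν` is the line of `z` translated by `−e_ν`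
    have hre : ∑ x, (if blockReg n M S (x + unitVec (fine n M) ν) then lineCurl n M e Z ν x else 0)
        = ∑ z, (if blockReg n M S z then lineCurl n M e Z ν (z - unitVec (fine n M) ν) else 0) := by
      rw [← sum_fine_sub_shift n M (fun x => if blockReg n M S (x + unitVec (fine n M) ν) then lineCurl n M e Z ν x else 0)
        (unitVec (fine n M) ν)]
      refine sum_congr rfl fun z _ => ?_
      simp only [sub_add_cancel]
    have hline : ∀ z, lineCurl n M e Z ν (z - unitVec (fine n M) ν)
        = ∑ s ∈ range (n + 1), g (xstart n M e z + tstep (fine n M) e s - unitVec (fine n M) ν) := by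
      intro z
      have hs : xstart n M e (z - unitVec (fine n M) ν) = xstart n M e z - unitVec (fine n M) ν := by
        rw [eq_sub_iff_add_eq, ← xstart_add_unitVec_ne n M e _ hν, sub_add_cancel]
      unfold lineCurl
      refine sum_congr rfl fun s _ => ?_
      rw [hs, add_sub_right_comm]
    rw [hre]
    simp_rw [hline]
    calc ∑ z, (if blockReg n M S z then ∑ s ∈ range (n + 1), g (xstart n M e z + tstep (fine n M) e s - unitVec (fine n M) ν) else 0)
        ≤ 2 * n * ∑ w, g (w - unitVec (fine n M) ν) :=
          sum_region_lineFun_le n M e S (g := fun w => g (w - unitVec (fine n M) ν)) fun w => hg0 _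
      _ = 2 * n * ∑ z, g z := by rw [sum_fine_sub_shift n M g (unitVec (fine n M) ν)]
  calc ∑ x, ‖res n M e S A (x, ν)‖ ^ 2
      ≤ ∑ x, 4 / (n : ℝ) * (((if blockReg n M S x then 1 else 0) + (if blockReg n M S (x + unitVec (fine n M) ν) then 1 else 0))
          * lineCurl n M e Z ν x) := sum_le_sum fun x _ => norm_sq_res_nu_le n M e A h hν x
    _ = 4 / (n : ℝ) * (∑ x, (if blockReg n M S x then lineCurl n M e Z ν x else 0)
          + ∑ x, (if blockReg n M S (x + unitVec (fine n M) ν) then lineCurl n M e Z ν x else 0)) := by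
        rw [← mul_sum, ← sum_add_distrib]
        congr 1
        refine sum_congr rfl fun x _ => ?_
        split_ifs <;> ring
    _ ≤ 4 / (n : ℝ) * (2 * n * ∑ z, g z + 2 * n * ∑ z, g z) := by gcongr
    _ = 16 * ∑ z, g z := by field_simp; ring

/-- the transverse curl lines are dominated by the full curl: `Σ_{ν≠e} Σ_z ‖F_{eν}(z)‖² ≤ nsq (CurlOp ext A) = 2·nsq (curlR A)`. [folklore] -/
theorem curl_lines_le :
    ∑ ν ∈ univ.filter (fun ν : Fin d => ν ≠ e), ∑ z, ‖Fs (fine n M) (n : ℂ) (ext (starReg n M S) A) e ν z‖ ^ 2 ≤ 2 * nsq (curlR n M S *ᵥ A) := by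
  set Z := ext (starReg n M S) A with hZ
  -- `curlR A = (√2)⁻¹ • CurlOp (ext A)`
  have hc : curlR n M S *ᵥ A = ((((Real.sqrt 2)⁻¹ : ℝ) : ℂ)) • (CurlOp (fine n M) (n : ℂ) *ᵥ Z) := by
    rw [curlR, Matrix.smul_mulVec, submatrix_mulVec_eq]
  have hnsq : 2 * nsq (curlR n M S *ᵥ A) = nsq (CurlOp (fine n M) (n : ℂ) *ᵥ Z) := by
    rw [hc, nsq_smul, Complex.norm_real, Real.norm_of_nonneg (by positivity), inv_pow, Real.sq_sqrt (by norm_num : (0:ℝ) ≤ 2)]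
    ring
  rw [hnsq]
  unfold nsq
  rw [Fintype.sum_prod_type, sum_comm]
  refine sum_le_sum fun z _ => ?_
  rw [Fintype.sum_prod_type]
  calc ∑ ν ∈ univ.filter (fun ν : Fin d => ν ≠ e), ‖Fs (fine n M) (n : ℂ) Z e ν z‖ ^ 2
      ≤ ∑ ν : Fin d, ‖Fs (fine n M) (n : ℂ) Z e ν z‖ ^ 2 := sum_le_sum_of_subset_of_nonneg (filter_subset _ _) fun _ _ _ => by positivity
    _ = ∑ ν : Fin d, ‖(CurlOp (fine n M) (n : ℂ) *ᵥ Z) (z, (e, ν))‖ ^ 2 := by simp_rw [CurlOp_mulVec]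
    _ ≤ ∑ μ : Fin d, ∑ ν : Fin d, ‖(CurlOp (fine n M) (n : ℂ) *ᵥ Z) (z, (μ, ν))‖ ^ 2 :=
        single_le_sum (f := fun μ => ∑ ν : Fin d, ‖(CurlOp (fine n M) (n : ℂ) *ᵥ Z) (z, (μ, ν))‖ ^ 2)
          (fun _ _ => sum_nonneg fun _ _ => by positivity) (mem_univ e)

/-- the direction split of `nsq (res A)`. [folklore] -/
theorem nsq_res_eq : nsq (res n M e S A)
    = ∑ x, ‖res n M e S A (x, e)‖ ^ 2 + ∑ ν ∈ univ.filter (fun ν : Fin d => ν ≠ e), ∑ x, ‖res n M e S A (x, ν)‖ ^ 2 := by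
  unfold nsq
  rw [Fintype.sum_prod_type, sum_comm, filter_ne', ← add_sum_erase _ _ (mem_univ e)]

/-! ## §2 The orbit inequality for the line gauge -/

/-- **THE LINE GAUGE IS A GOOD DIRICHLET GAUGE ON EVERY `e`-THIN BLOCK SET**:
`nsq (A − gradR (lineGauge A)) ≤ 40·nsq (curlR A) + 16·n^d·nsq (avgR A)` — constants free of `n`, `M`, `d` and of the block set. [folklore] -/
theorem nsq_sub_gradR_lineGauge_le (h : IsEThin M e S) :
    nsq (A - gradR n M S *ᵥ lineGauge n M e S A) ≤ 40 * nsq (curlR n M S *ᵥ A) + 16 * ((n : ℝ) ^ d * nsq (avgR n M S *ᵥ A)) := by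
  have hT := curl_lines_le n M e A
  have he := sum_res_e_sq_le n M e A h
  have hν : ∑ ν ∈ univ.filter (fun ν : Fin d => ν ≠ e), ∑ x, ‖res n M e S A (x, ν)‖ ^ 2
      ≤ 16 * ∑ ν ∈ univ.filter (fun ν : Fin d => ν ≠ e), ∑ z, ‖Fs (fine n M) (n : ℂ) (ext (starReg n M S) A) e ν z‖ ^ 2 := by
    rw [mul_sum]
    exact sum_le_sum fun ν hν => sum_res_nu_sq_le n M e A h (mem_filter.mp hν).2
  rw [nsq_sub_gradR_lineGauge, nsq_res_eq, avgR_mulVec]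
  linarith

/-! ## §3 The W1 ENDs on `e`-thin block sets -/

variable (a a' : ℝ) (S)

/-- **THE DISPLAYED W1 INEQUALITY HOLDS ON EVERY `e`-THIN BLOCK SET**: `OrthSliceCoercive (curlR) (gradR) (QOm) (avgR) (a·n^d) (orbitConst d a 40 16)`
(`2 ≤ n`, `0 < a`), the constant depending on `d`, `a` only. [folklore] -/
theorem orthSlice_of_isEThin (h : IsEThin M e S) (hn : 2 ≤ n) (ha : 0 < a) :
    OrthSliceCoercive (curlR n M S) (gradR n M S) (QOm n M S) (avgR n M S) (a * (n : ℝ) ^ d) (orbitConst d a 40 16) :=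
  orthSlice_of_gaugePoincare n M a S hn ha (by norm_num) fun A => ⟨lineGauge n M e S A, nsq_sub_gradR_lineGauge_le n M e A h⟩

/-- **LEAF-07-g5's DISPLAYED BINDER `SliceCoercive` HOLDS ON EVERY `e`-THIN BLOCK SET** with `c = orbitConst d a 40 16 / (1 + 4d/σ₀(d,a′))`
(`2 ≤ n`, `0 < a`, `0 < a′`) — uniform in `n`, `M` and the block set within the class. [folklore] -/
theorem sliceCoercive_of_isEThin (h : IsEThin M e S) (hn : 2 ≤ n) (ha : 0 < a) (ha' : 0 < a') :
    SliceCoercive (curlR n M S) (gradR n M S) (GOm n M a' S) (QOm n M S) (avgR n M S) (a * (n : ℝ) ^ d)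
      (orbitConst d a 40 16 / (1 + 4 * d / sigma0 d a')) :=
  sliceCoercive_region_of_orthSlice n M a a' S ha' (orbitConst_pos d ha (by norm_num)).le (orthSlice_of_isEThin n M e S a h hn ha)

/-- **A COERCIVITY CONSTANT FOR THE FAITHFUL REGION OPERATOR `Δ_a(Ω₀)` ON EVERY `e`-THIN BLOCK SET** (the owner's W1 socket `Coercive (D k) γ`,
level-uniform). [folklore] -/
theorem coercive_regionDeltaA_of_isEThin (h : IsEThin M e S) (hn : 2 ≤ n) (ha : 0 < a) (ha' : 0 < a') :
    Coercive (regionDeltaA n M a a' S) (min (orbitConst d a 40 16 / (1 + 4 * d / sigma0 d a') / 2) (1 / (2 * (gammaPs d a')⁻¹))) :=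
  coercive_regionDeltaA_of_orthSlice n M a a' S ha' (orbitConst_pos d ha (by norm_num)) (orthSlice_of_isEThin n M e S a h hn ha)

/-- **«G(Ω₀) EXISTS WITH A BOUND» ON EVERY `e`-THIN BLOCK SET**: `‖(Δ_a(Ω₀))⁻¹‖ ≤ (min (c′/2) (1/(2γ′⁻¹)))⁻¹`, `c′ = orbitConst d a 40 16/(1 + 4d/σ₀)`,
`γ′ = gammaPs d a′`. [cite: Balaban1985BackgroundPropagators, (3.27) p.395 (shape)] [folklore] -/
theorem opNorm_inv_regionDeltaA_le_of_isEThin (h : IsEThin M e S) (hn : 2 ≤ n) (ha : 0 < a) (ha' : 0 < a') :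
    ‖(regionDeltaA n M a a' S)⁻¹‖ ≤ (min (orbitConst d a 40 16 / (1 + 4 * d / sigma0 d a') / 2) (1 / (2 * (gammaPs d a')⁻¹)))⁻¹ :=
  opNorm_inv_regionDeltaA_le_of_orthSlice n M a a' S ha' (orbitConst_pos d ha (by norm_num)) (orthSlice_of_isEThin n M e S a h hn ha)

/-! ## §4 Non-vacuity of the class -/

variable {S}

omit [NeZero n] hM [DecidablePred S] in
/-- **LEVEL CRITERION**: if the `e`-coordinates of the blocks of `S` lie in a set `I ⊆ ℤ/M_e` WITHOUT CONSECUTIVE ELEMENTS (`I z → ¬ I (z+1)`),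
then `S` is `e`-thin — whatever its transverse shape (single blocks, `e`-slabs of thickness one, rods, staggered products …). [folklore] -/
theorem isEThin_of_levels {I : ZMod (M e) → Prop} (hI : ∀ z, I z → ¬ I (z + 1)) (hS : ∀ y, S y → I (y e)) : IsEThin M e S where
  noStack := by
    intro y hy h
    have h2 := hS _ h
    simp only [Pi.add_apply, unitVec, Pi.single_eq_same] at h2
    exact hI _ (hS y hy) h2
  noDiag := by
    intro y ν hν hy
    have hνe : (unitVec M ν) e = 0 := by simp [unitVec, Pi.single_eq_of_ne hν.symm]
    have hue : (unitVec M e) e = 1 := by simp [unitVec]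
    refine ⟨fun h => ?_, fun h => ?_⟩
    · have h2 := hS _ h
      simp only [Pi.add_apply, hνe, hue, add_zero] at h2
      exact hI _ (hS y hy) h2
    · have h2 := hS _ h
      simp only [Pi.add_apply, Pi.sub_apply, hνe, hue, sub_zero] at h2
      exact hI _ (hS y hy) h2

omit [NeZero n] hM [DecidablePred S] in
/-- a singleton level has no consecutive elements when `2 ≤ M e`. [folklore] -/
theorem level_single (hMe : 2 ≤ M e) (c : ZMod (M e)) : ∀ z, z = c → ¬ (z + 1 = c) := by
  rintro z rfl h
  haveI : Fact (1 < M e) := ⟨hMe⟩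
  exact one_ne_zero ((add_eq_left).mp h)

omit [NeZero n] hM [DecidablePred S] in
/-- **A SINGLE BLOCK IS `e`-THIN** (`2 ≤ M e`). [folklore] -/
theorem isEThin_single (hMe : 2 ≤ M e) (y₀ : Tor M) : IsEThin M e (fun y => y = y₀) :=
  isEThin_of_levels M e (I := fun z => z = y₀ e) (level_single M e hMe (y₀ e)) (by rintro y rfl; rfl)

omit [NeZero n] hM [DecidablePred S] in
/-- **AN `e`-SLAB OF THICKNESS ONE IS `e`-THIN** (`{y : y_e = c}`, `2 ≤ M e`) — the region on which the owner's O13-c (p228269) REFUTES the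
level-uniform zero-extension W2 binder; W1 nevertheless HOLDS there (§3). [folklore] -/
theorem isEThin_slab (hMe : 2 ≤ M e) (c : ZMod (M e)) : IsEThin M e (fun y => y e = c) :=
  isEThin_of_levels M e (I := fun z => z = c) (level_single M e hMe c) (fun _ h => h)

omit [NeZero n] hM [DecidablePred S] in
/-- **A PRODUCT / CYLINDER WITH AN `e`-ISOLATED LEVEL SET IS `e`-THIN**: `S y → I (y e)` with `I z → ¬ I (z + 1)` (e.g. `S y ↔ I (y e) ∧ T y` for any
transverse pattern `T`). [folklore] -/
theorem isEThin_cylinder {I : ZMod (M e) → Prop} {T : Tor M → Prop} (hI : ∀ z, I z → ¬ I (z + 1)) (hS : ∀ y, S y ↔ I (y e) ∧ T y) :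
    IsEThin M e S :=
  isEThin_of_levels M e hI fun y hy => ((hS y).mp hy).1

end Summit.QuantumFields.BalabanUV.T4Continuum.RegionStarLineGaugeEnd

end
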